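import Mathlib
import HarnessLib
import Summits.HubbardSuperconductivity.HubbardSuperconductivity.Theorems.KLProgrammeKLRegimeVolumeLimitSecondOrderLimit
import Summits.HubbardSuperconductivity.HubbardSuperconductivity.Theorems.KLProgrammeKLRegimeVolumeLimitTaylorOne

/-!
# Child `KLRegimeVolumeLimit` (stmt-HubbardSuperconductivity-19665 / its gen-3 twin) — the SECOND-ORDER TAYLOR TRUNCATION of the
# volume-limit carrier satisfies the VL text at every coupling (seat hubbard-kl-k3c5-p3)

The three landed rungs of the TRUE carrier `Σ̂^K_{L,M}(k,σ;U) = klSelfEnergy L M β U μ K klE0 (nScales β + 1) k σ` —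
`finalTwoLegVolLimit_zero_coupling` (U⁰, seat k3c5-p2), `firstOrder_volLimit` (U¹: frame-dressed Hartree tadpole, seat k3c5-p2) and
`secondOrder_volLimit` (U²: frame-dressed sunset + reducible double tadpole + tadpole-with-tadpole-insertion, `…SecondOrderLimit`) —
combined by the model-free algebra of VL clauses (`…VolumeLimitAlgebra`): for every `U`, `β > 0`, `μ`, frame `K` and thresholds `Mstar`,
the degree-two Taylor polynomial in the coupling,

  `T₂(L,M;k,σ;U) := Σ̂^K(k,σ;0) + U · ∂_U Σ̂^K(k,σ;0) + (U²/2) · ∂²_U Σ̂^K(k,σ;0)`,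

satisfies the three clauses of `FinalTwoLegVolLimit` verbatim (`secondOrderTaylor_volLimit`).  This is the order-`≤ 2` witness of
the volume-limit child as ONE citable statement — the deepest VL-shaped statement about the true carrier available before the engine
names its expansion (plan g10 2026-08-26T16:19:44Z ruling (α)).  Pure assembly; no definition.
-/

noncomputable section

namespace Summit.HubbardSuperconductivity.HubbardSuperconductivity.Theorems.TwoPointAssembly

set_option linter.dupNamespace false -- summit = problem name (single-conjunct summit), D-0017

open Finset Filter Topology Literature.MathematicalPhysics.QuantumLattice Literature.Probability.LatticeModels GrassmannAlgebra
open Summit.HubbardSuperconductivity.HubbardSuperconductivity.Theorems.KLRegimeSplit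
open Summit.HubbardSuperconductivity.HubbardSuperconductivity.Theorems.KLProgrammeLegKernels

/-- **The second-order Taylor truncation of the VL carrier satisfies the VL clauses at every `U`.** -/
theorem secondOrderTaylor_volLimit {β : ℝ} (hβ : 0 < β) (U μ : ℝ) (K : TrigPolyC4v) (Mstar : ℕ → ℕ) :
    ∃ sigmaInf : ℤ → (Fin 2 → ℝ) → Fin 2 → ℂ, ∃ B : ℝ, ∃ L₀ : ℕ,
      (∀ (n : ℤ) (σ : Fin 2), Continuous fun p : Fin 2 → ℝ => sigmaInf n p σ) ∧
      (∀ (L : ℕ) [NeZero L], L₀ ≤ L → ∀ (M : ℕ) [NeZero M], Mstar L ≤ M →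
        ∀ (k : FreqMomentum L M) (σ : Fin 2),
          ‖klSelfEnergy L M β 0 μ K klE0 (nScales β + 1) k σ +
                (U : ℂ) * deriv (fun U' : ℝ => klSelfEnergy L M β U' μ K klE0 (nScales β + 1) k σ) 0 +
              ((U ^ 2 / 2 : ℝ) : ℂ) * deriv (deriv fun U' : ℝ => klSelfEnergy L M β U' μ K klE0 (nScales β + 1) k σ) 0‖ ≤ B) ∧
      (∀ (n : ℤ) (σ : Fin 2) (ε : ℝ), 0 < ε → ∃ L₁ : ℕ, ∀ (L : ℕ) [NeZero L], L₁ ≤ L →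
        ∃ M₁ : ℕ, ∀ (M : ℕ) [NeZero M], M₁ ≤ M → ∀ ω : MatsubaraIdx M, matsubaraInt M ω = n →
          ∀ k : TorusSite 2 L,
            ‖(klSelfEnergy L M β 0 μ K klE0 (nScales β + 1) (ω, k) σ +
                  (U : ℂ) * deriv (fun U' : ℝ => klSelfEnergy L M β U' μ K klE0 (nScales β + 1) (ω, k) σ) 0 +
                ((U ^ 2 / 2 : ℝ) : ℂ) *
                  deriv (deriv fun U' : ℝ => klSelfEnergy L M β U' μ K klE0 (nScales β + 1) (ω, k) σ) 0) -
              sigmaInf n (latticeMomentum L k) σ‖ ≤ ε) := by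
  -- the degree-one truncation and the second-order rung
  obtain ⟨sig1, B1, L1, hc1, hb1, hl1⟩ := firstOrderTaylor_volLimit hβ U μ K Mstar
  obtain ⟨sig2, B2, L2, hc2, hb2, hl2⟩ := secondOrder_volLimit hβ μ K Mstar
  -- dress the U² rung by the constant `U²/2`
  have hB2 : 0 ≤ B2 := by
    set L' : ℕ := max L2 1 with hL'
    haveI : NeZero L' := ⟨by omega⟩
    set M' : ℕ := max (Mstar L') 1 with hM'
    haveI : NeZero M' := ⟨by omega⟩
    have hM'pos : 0 < 2 * M' := by omega
    have h := hb2 L' (le_max_left _ _) M' (le_max_left _ _) ((⟨0, hM'pos⟩ : MatsubaraIdx M'), fun _ => 0) 0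
    exact le_trans (norm_nonneg _) h
  obtain ⟨hcd, hbd, hld⟩ := volLimitShape_dressing_mul
    (S := fun L M _ _ k σ => deriv (deriv fun U' : ℝ => klSelfEnergy L M β U' μ K klE0 (nScales β + 1) k σ) 0)
    (Mstar := Mstar) (Φ := fun L M _ _ _ => ((U ^ 2 / 2 : ℝ) : ℂ)) (φ := fun _ _ => ((U ^ 2 / 2 : ℝ) : ℂ))
    (Bφ := ‖((U ^ 2 / 2 : ℝ) : ℂ)‖) (norm_nonneg _)
    (fun _ => continuous_const) (fun _ _ => le_rfl) (fun _ _ _ _ _ _ => rfl) hc2 hb2 hl2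
  -- add the degree-one truncation
  obtain ⟨hcs, hbs, hls⟩ := volLimitShape_add (Mstar := Mstar) hc1 hb1 hl1 hcd hbd hld
  exact ⟨fun n p σ => sig1 n p σ + ((U ^ 2 / 2 : ℝ) : ℂ) * sig2 n p σ, B1 + ‖((U ^ 2 / 2 : ℝ) : ℂ)‖ * B2, max L1 L2, hcs, hbs, hls⟩

end Summit.HubbardSuperconductivity.HubbardSuperconductivity.Theorems.TwoPointAssembly

end
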